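import Mathlib.Algebra.Group.Prod
import Mathlib.Data.Finset.Prod
import Mathlib.Tactic.Abel

/-!
# Self-converse lift of a two-family system — explicit / elementary route (siege k22)

Item `stmt-MatrixMultiplication-14308` (`FourierTwoFamiliesModP.PrimeTwoFamilies`, the CKSU two-families
property over prime cyclic hosts), line `Sketch`, registered stub `selfConverseLift`.

Setting.  `P Q : Fin r → Finset K` are `r` "letters" `(P c, Q c)` in an additive commutative group `K`;
`hD` says every letter is *direct* (`x - x' + (y - y') = 0` with `x, x' ∈ P c`, `y, y' ∈ Q c` forces
`x = x'`, `y = y'`), and `hπ` says that for every ordered pair of distinct letters `σ ≠ τ` the cross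
differences `Q τ - P σ` avoid every diagonal difference set `Q c - P c`, either for the pair itself or for
its image `(π σ, π τ)` under a self-map `π` of the letters.  The stub asserts that the `r` product blocks
`(P σ ×ˢ P (π σ), Q σ ×ˢ Q (π σ))` in `K × K` then satisfy

* (W) each block is direct, and
* (X) a relation `a - a' + (b - b') = 0` with `a` from block `i`, `a', b` from block `j` and `b'` from
  block `k` forces `i = k`.

Proof (entirely elementary, no transport through `Fin 2 → K` and no appeal to the general code lift).
The group structure on `K × K` is componentwise, so the relation splits into its two coordinates
(`Prod.fst_sub`, `Prod.fst_add`, … are definitional).  (W) is `hD σ` on the first coordinates and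
`hD (π σ)` on the second, glued by `Prod.ext`.  For (X) suppose `i ≠ k`; rewriting the coordinate
relations as `b'.1 - a.1 = b.1 - a'.1` and `b'.2 - a.2 = b.2 - a'.2` (`cross_sub_eq_diag_sub`), the first
alternative of `hπ i k` is refuted by the first coordinates with witness letter `c := j`, and the second
alternative by the second coordinates with witness letter `c := π j`.

Only the registered stub is proved (same name and signature, in its own namespace), plus one private
rearrangement lemma.
-/

-- single-conjunct summit: the mandated namespace repeats `MatrixMultiplication` (summit = sub-problem).
set_option linter.dupNamespace false

namespace Summit.MatrixMultiplication.MatrixMultiplication.Theorems.PrimeTwoFamilies.SelfConverseLiftK22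

/-- Rearrangement used for clause (X): the defining relation `x - x' + (y - y') = 0` of a block system
says exactly that the "cross" difference `y' - x` equals the "diagonal" difference `y - x'`. -/
private theorem cross_sub_eq_diag_sub {K : Type*} [AddCommGroup K] {x x' y y' : K}
    (h : (x - x') + (y - y') = 0) : y' - x = y - x' := by
  have key : y' - x - (y - x') = -((x - x') + (y - y')) := by abel
  rwa [h, neg_zero, sub_eq_zero] at key

/-- **Self-converse lift** (registered stub `selfConverseLift` of crux `PrimeTwoFamilies`, line `Sketch`).
If every letter `(P c, Q c)` is direct (`hD`) and a self-map `π` of the letters strongly separates every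
ordered pair of distinct letters either directly or after applying `π` (`hπ`), then the `r` product blocks
`(P σ ×ˢ P (π σ), Q σ ×ˢ Q (π σ))` in `K × K` satisfy clause (W) (first conjunct: each block is direct)
and clause (X) (second conjunct: `a - a' + (b - b') = 0` with `a ∈` block `i`, `a', b ∈` block `j`,
`b' ∈` block `k` forces `i = k`).  Elementary proof: split the relation into coordinates; (W) is `hD`
coordinatewise, and (X) follows because the first alternative of `hπ i k` is contradicted by the first
coordinates (witness letter `j`) and the second by the second coordinates (witness letter `π j`). -/
theorem selfConverseLift {K : Type*} [AddCommGroup K] [DecidableEq K] {r : ℕ}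
    (P Q : Fin r → Finset K)
    (hD : ∀ c : Fin r, ∀ x ∈ P c, ∀ x' ∈ P c, ∀ y ∈ Q c, ∀ y' ∈ Q c,
      (x - x') + (y - y') = 0 → x = x' ∧ y = y')
    (π : Fin r → Fin r)
    (hπ : ∀ σ τ : Fin r, σ ≠ τ →
      (∀ p ∈ P σ, ∀ q ∈ Q τ, ∀ c : Fin r, ∀ p' ∈ P c, ∀ q' ∈ Q c, q - p ≠ q' - p') ∨
      (∀ p ∈ P (π σ), ∀ q ∈ Q (π τ), ∀ c : Fin r, ∀ p' ∈ P c, ∀ q' ∈ Q c, q - p ≠ q' - p')) :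
    (∀ σ : Fin r, ∀ a ∈ P σ ×ˢ P (π σ), ∀ a' ∈ P σ ×ˢ P (π σ),
      ∀ b ∈ Q σ ×ˢ Q (π σ), ∀ b' ∈ Q σ ×ˢ Q (π σ),
        (a - a') + (b - b') = 0 → a = a' ∧ b = b') ∧
    (∀ i j k : Fin r, ∀ a ∈ P i ×ˢ P (π i), ∀ a' ∈ P j ×ˢ P (π j),
      ∀ b ∈ Q j ×ˢ Q (π j), ∀ b' ∈ Q k ×ˢ Q (π k),
        (a - a') + (b - b') = 0 → i = k) := by
  refine ⟨?_, ?_⟩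
  · -- (W): each product block is direct, coordinate by coordinate.
    intro σ a ha a' ha' b hb b' hb' h
    rw [Finset.mem_product] at ha ha' hb hb'
    have h1 : (a.1 - a'.1) + (b.1 - b'.1) = 0 := congrArg Prod.fst h
    have h2 : (a.2 - a'.2) + (b.2 - b'.2) = 0 := congrArg Prod.snd h
    obtain ⟨ha1, hb1⟩ := hD σ a.1 ha.1 a'.1 ha'.1 b.1 hb.1 b'.1 hb'.1 h1
    obtain ⟨ha2, hb2⟩ := hD (π σ) a.2 ha.2 a'.2 ha'.2 b.2 hb.2 b'.2 hb'.2 h2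
    exact ⟨Prod.ext ha1 ha2, Prod.ext hb1 hb2⟩
  · -- (X): if `i ≠ k`, one of the two coordinates violates the separation hypothesis `hπ i k`.
    intro i j k a ha a' ha' b hb b' hb' h
    rw [Finset.mem_product] at ha ha' hb hb'
    by_contra hik
    have h1 : b'.1 - a.1 = b.1 - a'.1 := cross_sub_eq_diag_sub (congrArg Prod.fst h)
    have h2 : b'.2 - a.2 = b.2 - a'.2 := cross_sub_eq_diag_sub (congrArg Prod.snd h)
    rcases hπ i k hik with hsep | hsep
    · exact hsep a.1 ha.1 b'.1 hb'.1 j a'.1 ha'.1 b.1 hb.1 h1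
    · exact hsep a.2 ha.2 b'.2 hb'.2 (π j) a'.2 ha'.2 b.2 hb.2 h2

end Summit.MatrixMultiplication.MatrixMultiplication.Theorems.PrimeTwoFamilies.SelfConverseLiftK22
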